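import Summits.BirchSwinnertonDyer.BirchSwinnertonDyer.Theorems.EdixhovenFibreFiveSevenStarredOptimalManinUnitFiveSevenReceptacleLogLattice
import Summits.BirchSwinnertonDyer.BirchSwinnertonDyer.Theorems.EdixhovenFibreFiveSevenStarredOptimalManinUnitFiveSevenUnramifiedTorsion
import Summits.BirchSwinnertonDyer.BirchSwinnertonDyer.Theorems.KimAtThreeFineKatoKPortCuspChart
import Summits.BirchSwinnertonDyer.Rank1Residual.Additive.GordTorsionFiveSeven
import Literature.NumberTheory.EllipticCurves.NonsingularReductionEmbedding
import Literature.NumberTheory.EllipticCurves.MazurTorsionStepOneAtNProofs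
import Literature.NumberTheory.EllipticCurves.VariableChangePointsMap
import Literature.NumberTheory.EllipticCurves.ModularCurveManinSemistableCoprimeFormProofs
import HarnessLib

/-!
# The receptacle hypothesis `E₀(K)[p] = 0` on K★'s locus: `p ∈ {5, 7}`, `v_p(c₄), v_p(c₆) ≥ 2`
# (every Kodaira type with `4 ≤ v_pΔ_min`), `K ⊇ ℚ_p` unramified — for the MINIMAL model, and the
# resulting SHARP receptacle `log_ω(E₀(K)) = 𝒪_K` for `W/ℚ` at a starred additive prime

Route `EdixhovenFibreFiveSeven`, crux K★ `StarredOptimalManinUnitFiveSeven` (stmt-BirchSwinnertonDyer-22226),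
line `kato-lever`, seat `bsd-line-edix-p1` g5; `--supports` 22226 (helper; programme piece P2 of
`Cruxes/StarredOptimalManinUnitFiveSeven/Lines/kato-lever-F2-programme.md` §4, K★-slice §3 (i)). TOOL theorems only
(no definition, no named fact, no instance, no `sorry`); nothing is closed or booked; BSD is not proved by any of this.

WHAT. The sibling `…ReceptacleLogLattice` proves `Λ̃ : E₀(K) ↠ 𝒪_K` (K/ℚ_p finite unramified, `p` odd, cuspidal
`M/ℤ_p`) under the displayed hypothesis `E₀(K)[p] = 0`. g4's `…UnramifiedTorsion` proves that hypothesis for the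
SHORT model `y² = x³ + ax + b`, `‖a‖, ‖b‖ ≤ ‖p‖²`, at points of abscissa `‖x‖ ≥ 1`, `p ∈ {5, 7}`. This file joins them
on the MINIMAL model `M = W_ℤ ⊗ ℤ_p` of a globally minimal `W/ℚ`:

* §1 `one_le_norm_X_of_mem_nonsingularReductionSubgroup_short` — on `y² = x³ + Ax + B`, `‖A‖, ‖B‖ < 1`, a point of
  `E₀(K)` has `‖x‖ ≥ 1` (a point with `‖x‖ < 1` reduces to the cusp `(0,0)`); `noPTorsion_short` — hence
  `E₀(K)[p] = 0` there for `p ∈ {5,7}`, `‖A‖, ‖B‖ ≤ p⁻²`, `K` unramified (g4's theorem).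
* §2 `noPTorsion_of_norm_c₄_c₆_le` — transport to ANY `M/ℤ_p` with `‖c₄‖, ‖c₆‖ ≤ p⁻²` along Mathlib's `toShortNF`
  (`u = 1`; `c₄ = −48A`, `c₆ = −864B`): `E₀` is preserved by an `𝒪_K`-integral change of variables
  (`hasNonsingularReduction_variableChange_some_iff`) and so is `p • P = O` (`VariableChange.pointEquiv`).
* §3 `norm_c₄_c₆_le_of_addv_of_four_le` — for `W/ℚ` globally minimal, `p ≥ 5` additive with `4 ≤ v_pΔ_min`:
  `v_p(c₄), v_p(c₆) ≥ 2` (`1728Δ = c₄³ − c₆²`; the tree's `v(c₄) = 1 ⇒ v(Δ) ≤ 3`, `v(c₆) = 1 ⇒ v(Δ) = 2`), read on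
  `M = W_ℤ ⊗ ℤ_p`; `noPTorsion_of_addv_of_four_le` — `E₀(K)[p] = 0` for `M ⊗ K`, `p ∈ {5,7}`, `K` unramified.
* §4 ★ `exists_mem_nonsingularReductionSubgroup_satLog_eq_of_addv_of_four_le` — **the K★ receptacle**: `W/ℚ` globally
  minimal, `p ∈ {5,7}` additive with `4 ≤ v_pΔ_min` (types IV, I₀*, IV*, III*, II* — K★'s starred locus included),
  `K/ℚ_p` finite unramified ⟹ `Λ̃ : E₀(K) ↠ 𝒪_K` for the minimal model; `…padicLogPointFiniteExt…` and the trace form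
  `norm_trace_mul_le_one_of_forall_point_of_addv_of_four_le` in (S5b)'s currency — with NO torsion hypothesis left.

References: [SilvermanAEC2009] VII.1.3, VII.2.1, VII.3.1, Exercise 3.7; [KostersPannekoek2017] Thm. 1 (iii)–(iv)
(`a₄ ≡ 10 (25)`, `a₆ ≡ 14 (49)` excluded by `v ≥ 2`); [KimNakamura2020] Cor. 2.4, Remark 1.8 (1); [Mazur1977] III §5 Step 1.
-/

set_option autoImplicit false
-- the Theorems namespace of a single-conjunct summit repeats the summit name by design (D-0017)
set_option linter.dupNamespace false

noncomputable section

open scoped Classical NNReal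
open WeierstrassCurve Literature.NumberTheory.EllipticCurves Literature.NumberTheory.EllipticCurves.FormalGroupChart
open Literature.NumberTheory.EllipticCurves.CuspJets
open Summit.BirchSwinnertonDyer.Rank1Residual.Additive
open Summit.BirchSwinnertonDyer.Rank1Residual.Additive.BallEval
open Summit.BirchSwinnertonDyer.BirchSwinnertonDyer.Theorems.KPort
open Literature.NumberTheory.GaloisRepresentations.LubinTate (unitBall mem_unitBall_iff)

namespace Summit.BirchSwinnertonDyer.BirchSwinnertonDyer.Theorems.StarredOptimalManinUnitFiveSevenReceptacle

variable {p : ℕ} [hp : Fact p.Prime] {K : Type*} [NontriviallyNormedField K] [NormedAlgebra ℚ_[p] K]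
  [IsUltrametricDist K]

/-! ## §1 The short model `y² = x³ + Ax + B` over `K` -/

section Short

variable {A B : ℤ_[p]}

/-- The reduction of `(y² = x³ + Ax + B) ⊗ 𝒪_K` with `‖A‖, ‖B‖ < 1` is the cuspidal cubic `y² = x³`. [folklore] -/
theorem map_residue_shortCurve_eq (hA : ‖A‖ < 1) (hB : ‖B‖ < 1) :
    ((shortCurve A B).map (coeffHom p K)).map (IsLocalRing.residue (unitBall K)) =
      shortCurve (0 : IsLocalRing.ResidueField (unitBall K)) 0 := by
  rw [CuspTorsion.map_shortCurve, CuspTorsion.map_shortCurve,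
    residue_eq_zero_of_norm_lt_one (by rw [norm_coe_coeffHom]; exact hA),
    residue_eq_zero_of_norm_lt_one (by rw [norm_coe_coeffHom]; exact hB)]

/-- **On `y² = x³ + Ax + B` with `‖A‖, ‖B‖ < 1`, a point of `E₀(K)` has abscissa of norm `≥ 1`**: a point with
`‖x‖ < 1` reduces to `(0, 0)`, the cusp of `ȳ² = x̄³`, which is singular. [cite: SilvermanAEC2009, VII.2 Prop. 2.1] -/
theorem one_le_norm_X_of_mem_nonsingularReductionSubgroup_short (hA : ‖A‖ < 1) (hB : ‖B‖ < 1) {x y : K}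
    (h : (curveK p K (shortCurve A B)).toAffine.Nonsingular x y)
    (hP : (Affine.Point.some x y h : (curveK p K (shortCurve A B)).toAffine.Point) ∈
      ((shortCurve A B).map (coeffHom p K)).nonsingularReductionSubgroup
        (Valuation.integer.integers (NormedField.valuation (K := K)))) :
    1 ≤ ‖x‖ := by
  by_contra hx
  rw [not_le] at hx
  have hns := nonsingular_residue_of_mem h hx.le hP
  have hx0 : IsLocalRing.residue (unitBall K) ⟨x, (mem_unitBall_iff K).mpr hx.le⟩ = 0 :=
    residue_eq_zero_of_norm_lt_one hx
  rw [map_residue_shortCurve_eq hA hB, hx0, Affine.nonsingular_iff', Affine.equation_iff'] at hns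
  obtain ⟨heq, hxy⟩ := hns
  simp only [zero_mul, mul_zero, add_zero, sub_zero, ne_eq, zero_pow two_ne_zero,
    zero_pow three_ne_zero, not_true_eq_false, false_or] at heq hxy
  -- `ȳ² = 0`, so `ȳ = 0`, so `2ȳ = 0`
  exact hxy (by rw [(pow_eq_zero_iff two_ne_zero).mp heq, mul_zero])

/-- **`E₀(K)[p] = 0` on the short model** `y² = x³ + Ax + B`, `‖A‖, ‖B‖ ≤ p⁻²`, `p ∈ {5, 7}`, `K ⊇ ℚ_p` complete
ultrametric UNRAMIFIED (`‖z‖ < 1 ⇒ ‖z‖ ≤ ‖p‖`): a point `P ∈ E₀(K)` with `p • P = O` is `O` — §1 above + g4's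
`not_zsmul_eq_zero_of_one_le_norm_unramified`. [cite: KostersPannekoek2017, Thm. 1 (iii)-(iv)] [cite: SilvermanAEC2009, Exercise 3.7(d),(f)] -/
theorem noPTorsion_short [hE : ((shortCurve A B).map PadicInt.Coe.ringHom).IsElliptic] (hp57 : p = 5 ∨ p = 7)
    (hK : ∀ z : K, ‖z‖ < 1 → ‖z‖ ≤ ‖(p : K)‖)
    (hA : ‖A‖ ≤ ((p : ℝ)⁻¹) ^ 2) (hB : ‖B‖ ≤ ((p : ℝ)⁻¹) ^ 2)
    {P : (curveK p K (shortCurve A B)).toAffine.Point}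
    (hP : P ∈ ((shortCurve A B).map (coeffHom p K)).nonsingularReductionSubgroup
      (Valuation.integer.integers (NormedField.valuation (K := K))))
    (hpP : p • P = 0) : P = 0 := by
  have hp0 : (p : K) ≠ 0 := norm_pos_iff.mp (norm_p_pos_lt (p := p) (K := K)).1
  have hp1 : ‖(p : K)‖ < 1 := (norm_p_pos_lt (p := p) (K := K)).2
  have hpK : ‖(p : K)‖ = (p : ℝ)⁻¹ := HondaFss.norm_natCast_p (p := p) (K := K)
  have hpinv : ((p : ℝ)⁻¹) ^ 2 < 1 := by
    have : (p : ℝ)⁻¹ < 1 := by rw [← hpK]; exact hp1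
    have h0 : 0 ≤ (p : ℝ)⁻¹ := by positivity
    nlinarith
  have hA1 : ‖A‖ < 1 := hA.trans_lt hpinv
  have hB1 : ‖B‖ < 1 := hB.trans_lt hpinv
  rcases P with _ | ⟨x, y, h⟩
  · rfl
  · exfalso
    have hx := one_le_norm_X_of_mem_nonsingularReductionSubgroup_short hA1 hB1 h hP
    haveI : ((shortCurve A B).map ((unitBall K).subtype.comp (coeffHom p K))).IsElliptic :=
      isElliptic_curveK p K (shortCurve A B)
    have hf : ∀ r : ℤ_[p], ‖((unitBall K).subtype.comp (coeffHom p K)) r‖ ≤ 1 := fun r => by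
      rw [RingHom.comp_apply, Subring.subtype_apply, norm_coe_coeffHom]; exact PadicInt.norm_le_one r
    have hA' : ‖((unitBall K).subtype.comp (coeffHom p K)) A‖ ≤ ‖(p : K)‖ ^ 2 := by
      rw [RingHom.comp_apply, Subring.subtype_apply, norm_coe_coeffHom, hpK]; exact hA
    have hB' : ‖((unitBall K).subtype.comp (coeffHom p K)) B‖ ≤ ‖(p : K)‖ ^ 2 := by
      rw [RingHom.comp_apply, Subring.subtype_apply, norm_coe_coeffHom, hpK]; exact hB
    have hne := StarredOptimalManinUnitFiveSevenUnramifiedTorsion.not_zsmul_eq_zero_of_one_le_norm_unramified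
      ((unitBall K).subtype.comp (coeffHom p K)) hf hp57 hp0 hp1 hK hA' hB' h hx
    exact hne (by rw [natCast_zsmul]; exact hpP)

end Short

/-! ## §2 Transport to any `ℤ_p`-model with `‖c₄‖, ‖c₆‖ ≤ p⁻²` along `toShortNF` -/

section Transport

variable {M : WeierstrassCurve ℤ_[p]} [hE : (M.map PadicInt.Coe.ringHom).IsElliptic]
  [hint : (curveK p K M).IsIntegral (NormedField.valuation (K := K)).integer]

/-- **`E₀(K)[p] = 0` for ANY `M/ℤ_p` with `‖c₄(M)‖, ‖c₆(M)‖ ≤ p⁻²**, `p ∈ {5, 7}`, `K ⊇ ℚ_p` complete ultrametric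
unramified: Mathlib's `toShortNF` is a change of variables `D = (1, r, s, t)` over `ℤ_p` (`2, 3 ∈ ℤ_pˣ`) with
`D • M = (y² = x³ + Ax + B)`, `c₄ = −48A`, `c₆ = −864B`; `E₀(K)` and `p • P = O` are transported along the induced
isomorphism of point groups (`hasNonsingularReduction_variableChange_some_iff`, `VariableChange.pointEquiv`), and §1
applies. [cite: SilvermanAEC2009, VII.1 Prop. 1.3 and Exercise 3.7] [cite: KostersPannekoek2017, Thm. 1 (iii)-(iv)] -/
theorem noPTorsion_of_norm_c₄_c₆_le (hp57 : p = 5 ∨ p = 7) (hK : ∀ z : K, ‖z‖ < 1 → ‖z‖ ≤ ‖(p : K)‖)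
    (h4 : ‖M.c₄‖ ≤ ((p : ℝ)⁻¹) ^ 2) (h6 : ‖M.c₆‖ ≤ ((p : ℝ)⁻¹) ^ 2)
    {P : (curveK p K M).toAffine.Point}
    (hP : P ∈ (M.map (coeffHom p K)).nonsingularReductionSubgroup
      (Valuation.integer.integers (NormedField.valuation (K := K))))
    (hpP : p • P = 0) : P = 0 := by
  have hp5 : 5 ≤ p := by rcases hp57 with rfl | rfl <;> norm_num
  obtain ⟨h2, h3⟩ := norm_two_three (p := p) hp5
  haveI : Invertible (2 : ℤ_[p]) := (PadicInt.isUnit_iff.mpr h2).invertible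
  haveI : Invertible (3 : ℤ_[p]) := (PadicInt.isUnit_iff.mpr h3).invertible
  set D : VariableChange ℤ_[p] := M.toShortNF with hD
  have hDu : D.u = 1 := toShortNF_u M
  haveI hNF : (D • M).IsShortNF := WeierstrassCurve.toShortNF_spec M
  set A := (D • M).a₄ with hA'
  set B := (D • M).a₆ with hB'
  have hM : D • M = shortCurve A B := WeierstrassCurve.ext hNF.a₁ hNF.a₂ hNF.a₃ rfl rfl
  -- `‖A‖, ‖B‖ ≤ p⁻²` from `c₄ = -48A`, `c₆ = -864B` (`u = 1`)
  have ec₄ : (shortCurve A B).c₄ = M.c₄ := by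
    rw [← hM, variableChange_c₄, hDu, inv_one, Units.val_one, one_pow, one_mul]
  have ec₆ : (shortCurve A B).c₆ = M.c₆ := by
    rw [← hM, variableChange_c₆, hDu, inv_one, Units.val_one, one_pow, one_mul]
  have hA : ‖A‖ ≤ ((p : ℝ)⁻¹) ^ 2 := by
    have h := h4
    rw [← ec₄, (shortCurve_c₄_Δ A B).1, show (-48 : ℤ_[p]) * A = -(2 ^ 4 * 3 * A) by ring, norm_neg,
      norm_mul, norm_mul, norm_pow, h2, h3, one_pow, one_mul, one_mul] at h
    exact h
  have hB : ‖B‖ ≤ ((p : ℝ)⁻¹) ^ 2 := by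
    have h := h6
    rw [← ec₆, CuspTorsion.shortCurve_c₆ A B, show (-864 : ℤ_[p]) * B = -(2 ^ 5 * 3 ^ 3 * B) by ring,
      norm_neg, norm_mul, norm_mul, norm_pow, norm_pow, h2, h3, one_pow, one_pow, one_mul, one_mul] at h
    exact h
  -- ellipticity and integrality of the short model
  haveI hE' : ((shortCurve A B).map PadicInt.Coe.ringHom).IsElliptic := by
    rw [← hM, ← map_variableChange]; infer_instance
  haveI : (curveK p K (shortCurve A B)).IsIntegral (NormedField.valuation (K := K)).integer :=
    isIntegral_curveK p K (shortCurve A B)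
  -- the change of variables over `K` and the induced isomorphism of point groups
  set f : ℤ_[p] →+* K := (unitBall K).subtype.comp (coeffHom p K) with hf
  have hcurve : (D.map f) • curveK p K M = curveK p K (shortCurve A B) := by
    rw [curveK, curveK, map_variableChange, hM]
  set e := VariableChange.pointEquiv (curveK p K M) (D.map f) with he
  rcases P with _ | ⟨x, y, h⟩
  · rfl
  · exfalso
    -- the transported point `Q = (x', y')` on the short model
    have h' : (curveK p K (shortCurve A B)).toAffine.Nonsingular ((D.map f).toX x) ((D.map f).toY x y) := by
      rw [← hcurve]; exact (VariableChange.nonsingular_iff _ _ x y).mpr h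
    have hQ : Affine.Point.congrEquiv hcurve (e (.some x y h)) = .some ((D.map f).toX x) ((D.map f).toY x y) h' := by
      rw [he, VariableChange.pointEquiv_some, Affine.Point.congrEquiv_some]
    -- `Q ∈ E₀(K)` of the short model
    have hV : (D.map (coeffHom p K)) • (M.map (coeffHom p K)) = (shortCurve A B).map (coeffHom p K) := by
      rw [map_variableChange, hM]
    have hfD : (D.map (coeffHom p K)).map (algebraMap (unitBall K) K) = D.map f := by
      rw [VariableChange.map_map]; rfl
    have hQ0 : ((shortCurve A B).map (coeffHom p K)).HasNonsingularReduction
        (Affine.Point.some ((D.map f).toX x) ((D.map f).toY x y) h') :=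
      (hasNonsingularReduction_variableChange_some_iff (Ω := K) (M.map (coeffHom p K))
        (D.map (coeffHom p K)) hV (by rw [hfD]) (by rw [hfD]) h h').mpr hP
    -- `p • Q = O`, hence `Q = O` by §1 — contradiction
    have hpQ : p • (Affine.Point.some ((D.map f).toX x) ((D.map f).toY x y) h' :
        (curveK p K (shortCurve A B)).toAffine.Point) = 0 := by
      rw [← hQ, ← map_nsmul, ← map_nsmul, hpP, map_zero, map_zero]
    exact absurd (noPTorsion_short hp57 hK hA hB hQ0 hpQ) (Affine.Point.some_ne_zero h')

end Transport

/-! ## §3 `W/ℚ` globally minimal, `p ≥ 5` additive, `4 ≤ v_pΔ_min`: `v_p(c₄), v_p(c₆) ≥ 2` on `W_ℤ ⊗ ℤ_p` -/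

section Rat

variable (W : WeierstrassCurve ℚ) [W.IsElliptic] [W.IsGloballyMinimal]

omit [NontriviallyNormedField K] [NormedAlgebra ℚ_[p] K] [IsUltrametricDist K] in
/-- An integer `z` with `z = 0 ∨ 2 ≤ v_p(z)` has `‖z‖_p ≤ p⁻²` in `ℤ_p`. [folklore] -/
theorem norm_intCast_le_of_two_le_padicValInt {z : ℤ} (hz : z = 0 ∨ 2 ≤ padicValInt p z) :
    ‖(z : ℤ_[p])‖ ≤ ((p : ℝ)⁻¹) ^ 2 := by
  have hdvd : ((p : ℤ) ^ 2) ∣ z := (padicValInt_dvd_iff 2 z).mpr hz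
  have h := (PadicInt.norm_int_le_pow_iff_dvd (p := p) (k := z) (n := 2)).mpr (by exact_mod_cast hdvd)
  rw [inv_pow, ← zpow_natCast, ← zpow_neg]
  exact_mod_cast h

omit [NontriviallyNormedField K] [NormedAlgebra ℚ_[p] K] [IsUltrametricDist K] in
/-- **At an additive `p ≥ 5` with `4 ≤ v_pΔ_min`: `v_p(c₄) ≥ 2` and `v_p(c₆) ≥ 2`** (or the invariant vanishes), read
on `M = W_ℤ ⊗ ℤ_p` as `‖c₄(M)‖, ‖c₆(M)‖ ≤ p⁻²`. From `1728Δ = c₄³ − c₆²` with `p ∣ c₄, c₆`: `v(c₄) = 1` would force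
`v(Δ) ∈ {2,3}` and `v(c₆) = 1` would force `v(Δ) = 2` (tree: `GordTorsionFiveSeven`). These are the Kodaira types
IV, I₀*, IV*, III*, II* (and Iₙ*), i.e. all additive types but II and III. [cite: SilvermanATAEC1994, IV Table 4.1] -/
theorem norm_c₄_c₆_le_of_addv_of_four_le (hp5 : 5 ≤ p) (hadd : Rank1Residual.Addv W p)
    (hv : 4 ≤ padicValInt p W.minimalDiscriminantInt) :
    ‖((integralModelInt W).map (Int.castRingHom ℤ_[p])).c₄‖ ≤ ((p : ℝ)⁻¹) ^ 2 ∧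
      ‖((integralModelInt W).map (Int.castRingHom ℤ_[p])).c₆‖ ≤ ((p : ℝ)⁻¹) ^ 2 := by
  obtain ⟨h4, h6⟩ := padicValRat_c₄_c₆_of_addv W p hadd
  have h4' : W.c₄ = 0 ∨ 2 ≤ padicValRat p W.c₄ := by
    rcases h4 with h | h
    · exact Or.inl h
    · right
      by_contra hlt
      have h1 : padicValRat p W.c₄ = 1 := by omega
      rcases padicValInt_minimalDiscriminantInt_of_padicValRat_c₄_eq_one W p hp5 hadd h1 with h' | h' <;> omega
  have h6' : W.c₆ = 0 ∨ 2 ≤ padicValRat p W.c₆ := by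
    rcases h6 with h | h
    · exact Or.inl h
    · right
      by_contra hlt
      have h1 : padicValRat p W.c₆ = 1 := by omega
      have h' := padicValInt_minimalDiscriminantInt_eq_two_of_padicValRat_c₆_eq_one W p hp5 hadd h1
      omega
  rw [map_c₄, map_c₆, eq_intCast, eq_intCast]
  rw [← cast_integralModelInt_c₄ W] at h4'
  rw [← cast_integralModelInt_c₆ W] at h6'
  refine ⟨norm_intCast_le_of_two_le_padicValInt ?_, norm_intCast_le_of_two_le_padicValInt ?_⟩
  · rcases h4' with h | h
    · exact Or.inl (by exact_mod_cast h)
    · exact Or.inr (by rw [padicValRat.of_int] at h; exact_mod_cast h)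
  · rcases h6' with h | h
    · exact Or.inl (by exact_mod_cast h)
    · exact Or.inr (by rw [padicValRat.of_int] at h; exact_mod_cast h)

omit [NontriviallyNormedField K] [NormedAlgebra ℚ_[p] K] [IsUltrametricDist K] in
/-- The `ℤ_p`-model `W_ℤ ⊗ ℤ_p` of a globally minimal `W/ℚ` has elliptic generic fibre (a theorem; use with `haveI`).
[folklore] -/
theorem isElliptic_map_integralModelInt_padic :
    (((integralModelInt W).map (Int.castRingHom ℤ_[p])).map (PadicInt.Coe.ringHom (p := p))).IsElliptic := by
  rw [map_coe_integralModelInt]; infer_instance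

/-- **`E₀(K)[p] = 0` for the minimal model of `W/ℚ` over every UNRAMIFIED complete `K ⊇ ℚ_p`** at an additive
`p ∈ {5, 7}` with `4 ≤ v_pΔ_min` (in particular on K★'s starred locus `4 < v_pΔ_min`, and for every residue degree:
the Kosters–Pannekoek invariant `ā` vanishes there). [cite: KostersPannekoek2017, Thm. 1 (iii)-(iv)] [cite: KimNakamura2020, Remark 1.8 (1)] -/
theorem noPTorsion_of_addv_of_four_le (hp57 : p = 5 ∨ p = 7) (hadd : Rank1Residual.Addv W p)
    (hv : 4 ≤ padicValInt p W.minimalDiscriminantInt) (hK : ∀ z : K, ‖z‖ < 1 → ‖z‖ ≤ ‖(p : K)‖)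
    [(curveK p K ((integralModelInt W).map (Int.castRingHom ℤ_[p]))).IsIntegral
      (NormedField.valuation (K := K)).integer]
    {P : (curveK p K ((integralModelInt W).map (Int.castRingHom ℤ_[p]))).toAffine.Point}
    (hP : P ∈ (((integralModelInt W).map (Int.castRingHom ℤ_[p])).map (coeffHom p K)).nonsingularReductionSubgroup
      (Valuation.integer.integers (NormedField.valuation (K := K))))
    (hpP : p • P = 0) : P = 0 := by
  haveI := isElliptic_map_integralModelInt_padic (p := p) W
  have hp5 : 5 ≤ p := by rcases hp57 with rfl | rfl <;> norm_num
  obtain ⟨h4, h6⟩ := norm_c₄_c₆_le_of_addv_of_four_le (p := p) W hp5 hadd hv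
  exact noPTorsion_of_norm_c₄_c₆_le hp57 hK h4 h6 hP hpP

end Rat

/-! ## §4 ★ The K★ receptacle: `log_ω(E₀(K)) = 𝒪_K` for the minimal model of `W/ℚ` at a starred additive `p ∈ {5,7}` -/

section KStar

variable [CompleteSpace K] (W : WeierstrassCurve ℚ) [W.IsElliptic] [W.IsGloballyMinimal]
  [(curveK p K ((integralModelInt W).map (Int.castRingHom ℤ_[p]))).IsIntegral
    (NormedField.valuation (K := K)).integer]

/-- ★ **THE K★ RECEPTACLE.** `W/ℚ` globally minimal, `p ∈ {5, 7}` additive for `W` with `4 ≤ v_pΔ_min`, `K/ℚ_p`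
finite and UNRAMIFIED: `Λ̃ : E₀(K) ↠ 𝒪_K` for the minimal model `W_ℤ ⊗ K` — the sharp log-lattice
`log_ω(E₀(K)) = 𝒪_K` of Kim–Nakamura Cor. 2.4 / Kosters–Pannekoek over every unramified completion `K = ℚ(ζ_m)_v`,
`p ∤ m`, with no torsion hypothesis (discharged by §3). [cite: KimNakamura2020, Thm. 2.1, Cor. 2.4, Remark 1.8 (1)]
[cite: KostersPannekoek2017, Thm. 1] [cite: SilvermanAEC2009, VII.2 Prop. 2.1, III.2.5 with Exercise 3.5, Thm. IV.6.4] -/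
theorem exists_mem_nonsingularReductionSubgroup_satLog_eq_of_addv_of_four_le [FiniteDimensional ℚ_[p] K]
    (hp57 : p = 5 ∨ p = 7) (hadd : Rank1Residual.Addv W p) (hv : 4 ≤ padicValInt p W.minimalDiscriminantInt)
    (hK : ∀ z : K, ‖z‖ < 1 → ‖z‖ ≤ ‖(p : K)‖) {y : K} (hy : ‖y‖ ≤ 1) :
    ∃ P ∈ (((integralModelInt W).map (Int.castRingHom ℤ_[p])).map (coeffHom p K)).nonsingularReductionSubgroup
        (Valuation.integer.integers (NormedField.valuation (K := K))),
      satLog p K ((integralModelInt W).map (Int.castRingHom ℤ_[p])) P = y := by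
  have hp2 : p ≠ 2 := by rcases hp57 with rfl | rfl <;> norm_num
  haveI := isElliptic_map_integralModelInt_padic (p := p) W
  obtain ⟨hΔ, hc₄⟩ := norm_Δ_lt_one_of_addv (p := p) W hadd
  exact exists_mem_nonsingularReductionSubgroup_satLog_eq hp2 hK hΔ hc₄
    (fun P hP hpP => noPTorsion_of_addv_of_four_le W hp57 hadd hv hK hP hpP) hy

/-- `Λ̃(E₀(K)) = 𝒪_K` for the minimal model of `W/ℚ` (same hypotheses). [cite: KimNakamura2020, Cor. 2.4] -/
theorem image_satLog_nonsingularReductionSubgroup_eq_of_addv_of_four_le [FiniteDimensional ℚ_[p] K]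
    (hp57 : p = 5 ∨ p = 7) (hadd : Rank1Residual.Addv W p) (hv : 4 ≤ padicValInt p W.minimalDiscriminantInt)
    (hK : ∀ z : K, ‖z‖ < 1 → ‖z‖ ≤ ‖(p : K)‖) :
    satLog p K ((integralModelInt W).map (Int.castRingHom ℤ_[p])) ''
        {P : (curveK p K ((integralModelInt W).map (Int.castRingHom ℤ_[p]))).toAffine.Point |
          P ∈ (((integralModelInt W).map (Int.castRingHom ℤ_[p])).map (coeffHom p K)).nonsingularReductionSubgroup
            (Valuation.integer.integers (NormedField.valuation (K := K)))} =
      {y : K | ‖y‖ ≤ 1} := by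
  have hp2 : p ≠ 2 := by rcases hp57 with rfl | rfl <;> norm_num
  haveI := isElliptic_map_integralModelInt_padic (p := p) W
  obtain ⟨hΔ, hc₄⟩ := norm_Δ_lt_one_of_addv (p := p) W hadd
  exact image_satLog_nonsingularReductionSubgroup_eq hp2 hK hΔ hc₄
    (fun P hP hpP => noPTorsion_of_addv_of_four_le W hp57 hadd hv hK hP hpP)

/-- `Λ̃` is injective on `E₀(K)` for the minimal model of `W/ℚ` (same hypotheses): `Λ̃ P = 0 ↔ P = O`.
[cite: SilvermanAEC2009, VII.2 Prop. 2.1 and Thm. IV.6.4] -/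
theorem satLog_eq_zero_iff_of_addv_of_four_le (hp57 : p = 5 ∨ p = 7) (hadd : Rank1Residual.Addv W p)
    (hv : 4 ≤ padicValInt p W.minimalDiscriminantInt) (hK : ∀ z : K, ‖z‖ < 1 → ‖z‖ ≤ ‖(p : K)‖)
    {P : (curveK p K ((integralModelInt W).map (Int.castRingHom ℤ_[p]))).toAffine.Point}
    (hP : P ∈ (((integralModelInt W).map (Int.castRingHom ℤ_[p])).map (coeffHom p K)).nonsingularReductionSubgroup
      (Valuation.integer.integers (NormedField.valuation (K := K)))) :
    satLog p K ((integralModelInt W).map (Int.castRingHom ℤ_[p])) P = 0 ↔ P = 0 := by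
  have hp2 : p ≠ 2 := by rcases hp57 with rfl | rfl <;> norm_num
  haveI := isElliptic_map_integralModelInt_padic (p := p) W
  obtain ⟨hΔ, hc₄⟩ := norm_Δ_lt_one_of_addv (p := p) W hadd
  exact satLog_eq_zero_iff_of_mem_nonsingularReductionSubgroup hp2 hK hΔ hc₄
    (fun P hP hpP => noPTorsion_of_addv_of_four_le W hp57 hadd hv hK hP hpP) hP

/-- The same in (S5b)'s currency: every `y ∈ 𝒪_K` is `FormalGroupChart.padicLogPointFiniteExt ‖·‖ E p P` for some
`P ∈ E₀(K)` of the minimal model. [cite: KimNakamura2020, Cor. 2.4] [cite: SilvermanAEC2009, Thm. IV.6.4 with Prop. VII.2.2] -/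
theorem exists_mem_nonsingularReductionSubgroup_padicLogPointFiniteExt_eq_of_addv_of_four_le
    [FiniteDimensional ℚ_[p] K] (hp57 : p = 5 ∨ p = 7) (hadd : Rank1Residual.Addv W p)
    (hv : 4 ≤ padicValInt p W.minimalDiscriminantInt) (hK : ∀ z : K, ‖z‖ < 1 → ‖z‖ ≤ ‖(p : K)‖)
    {y : K} (hy : ‖y‖ ≤ 1) :
    ∃ P ∈ (((integralModelInt W).map (Int.castRingHom ℤ_[p])).map (coeffHom p K)).nonsingularReductionSubgroup
        (Valuation.integer.integers (NormedField.valuation (K := K))),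
      padicLogPointFiniteExt (NormedField.valuation (K := K))
        (curveK p K ((integralModelInt W).map (Int.castRingHom ℤ_[p]))) p P = y := by
  have hp2 : p ≠ 2 := by rcases hp57 with rfl | rfl <;> norm_num
  haveI := isElliptic_map_integralModelInt_padic (p := p) W
  obtain ⟨hΔ, hc₄⟩ := norm_Δ_lt_one_of_addv (p := p) W hadd
  exact exists_mem_nonsingularReductionSubgroup_padicLogPointFiniteExt_eq hp2 hK hΔ hc₄
    (fun P hP hpP => noPTorsion_of_addv_of_four_le W hp57 hadd hv hK hP hpP) hy

/-- ★ **The trace form consumed with (S5b)**, no torsion hypothesis: `W/ℚ` globally minimal, `p ∈ {5,7}` additive with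
`4 ≤ v_pΔ_min`, `K/ℚ_p` finite unramified; if `‖Tr_{K/ℚ_p}(a · log_ω P)‖ ≤ 1` for every `P ∈ E(K)` (the RHS of
`PAdicHodge.exists_smul_range_expStarCoord_iff_trace_log` for the model `W_ℤ ⊗ K`: `a ∈ exp*_ω(H¹(K, T_pE))`), then
`‖Tr_{K/ℚ_p}(a · o)‖ ≤ 1` for every `o ∈ 𝒪_K` — `exp*_ω(H¹(K_v, T_pE)) ⊆ 𝒪_v^∨ (= 𝒪_v)`, the receptacle of F″ on
K★'s locus. [cite: KimNakamura2020, Thm. 2.1 and Cor. 2.4] [cite: SilvermanAEC2009, Thm. IV.6.4] -/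
theorem norm_trace_mul_le_one_of_forall_point_of_addv_of_four_le [FiniteDimensional ℚ_[p] K]
    (hp57 : p = 5 ∨ p = 7) (hadd : Rank1Residual.Addv W p) (hv : 4 ≤ padicValInt p W.minimalDiscriminantInt)
    (hK : ∀ z : K, ‖z‖ < 1 → ‖z‖ ≤ ‖(p : K)‖) {a : K}
    (ha : ∀ P : (curveK p K ((integralModelInt W).map (Int.castRingHom ℤ_[p]))).toAffine.Point,
      ‖Algebra.trace ℚ_[p] K (a * padicLogPointFiniteExt (NormedField.valuation (K := K))
        (curveK p K ((integralModelInt W).map (Int.castRingHom ℤ_[p]))) p P)‖ ≤ 1)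
    {o : K} (ho : ‖o‖ ≤ 1) : ‖Algebra.trace ℚ_[p] K (a * o)‖ ≤ 1 := by
  have hp2 : p ≠ 2 := by rcases hp57 with rfl | rfl <;> norm_num
  haveI := isElliptic_map_integralModelInt_padic (p := p) W
  obtain ⟨hΔ, hc₄⟩ := norm_Δ_lt_one_of_addv (p := p) W hadd
  exact norm_trace_mul_le_one_of_forall_point hp2 hK hΔ hc₄
    (fun P hP hpP => noPTorsion_of_addv_of_four_le W hp57 hadd hv hK hP hpP) ha ho

end KStar

end Summit.BirchSwinnertonDyer.BirchSwinnertonDyer.Theorems.StarredOptimalManinUnitFiveSevenReceptacle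

end
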